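import Summits.AnomalousDissipation.AnomalousDissipation.Theorems.GalerkinInvariantLoud.Negative.Clauses

/-!
# Negative knowledge for the crux `MomentParity.GalerkinInvariantLoud` (stmt-AnomalousDissipation-14283), VI:
# line `taylor-cone-homogenisation` — the `j`-uniformity of the cone slope is the load-bearing clause

Certified copy of §6 of the cdisprove work file `Cruxes/GalerkinInvariantLoud/Disproof.lean`
(refuter-cdisprove-stmt-AnomalousDissipation-14283-0, cycle 1). Supports stmt-AnomalousDissipation-14283; no
conclusion asserts a Theses decl positively.

* `TSE` — the Taylor-scale ensemble of the picked line (second hypothesis of its `stub_taylorReduction`, conclusion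
  of its `taylorConverse`): invariant level-`N` laws in the cone `κ·e ≤ D`, ONE `κ > 0` for all `j`.
* `TSEWithoutUniformKappa`, `tseWithoutUniformKappa_holds` — with `κ` chosen after `j` the statement is trivial:
  the laminar Kolmogorov Diracs lie ON the cone of slope `4π²ν_j` (`laminar_cone_eq`), force `K_1 ≠ 0`
  (`kolField_one_ne_zero`). So the `j`-uniform `κ` is the only load-bearing clause of TSE / of the line's open stub S4.
* `cone_level'` — a cone witness with positive energy lives at `N ≥ (κ/ν)^{1/2}/(2π)` (Bernstein).
-/

namespace Summit.AnomalousDissipation.AnomalousDissipation.Theorems.GalerkinInvariantLoud.Negative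

open MeasureTheory Filter Topology
open scoped ENNReal InnerProductSpace RealInnerProductSpace
open Literature.Analysis.FunctionSpaces Literature.Analysis.FluidPDE
open Summit.AnomalousDissipation.AnomalousDissipation.Theses.MomentParity
open Summit.AnomalousDissipation.AnomalousDissipation.Theorems
open Summit.AnomalousDissipation.AnomalousDissipation.Theorems.QuarticGate.Negative

noncomputable section

open Summit.AnomalousDissipation.AnomalousDissipation.Theorems.CubicParityLoud.Negative (T3 R3 H3 L2T3)

section LineTaylorCone

/-- TSE, the Taylor-scale ensemble (verbatim second hypothesis of `stub_taylorReduction` / conclusion of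
`taylorConverse`): invariant level-`N` laws in the cone `κ·e ≤ D` with ONE `κ > 0` for all `j`. -/
def TSE : Prop :=
  ∃ f : T3 → R3, Torus.IsSmooth f ∧ Torus.IsDivFree f ∧ Torus.HasZeroMean f ∧ f ≠ 0 ∧
    ∃ (ν : ℕ → ℝ) (κ : ℝ), (∀ j, 0 < ν j) ∧ Tendsto ν atTop (𝓝 0) ∧ 0 < κ ∧
      ∀ j : ℕ, ∃ R : ℝ, ∃ᶠ N in atTop, ∃ μ : Measure H3,
        IsProbabilityMeasure μ ∧ (∀ᵐ u ∂μ, IsLevel N u) ∧ (∀ᵐ u ∂μ, ‖u‖ ≤ R) ∧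
        (∀ d : ℕ, IsPolyStationary (ν j) f N d μ) ∧
        κ * Torus.ensembleEnergy μ ≤ Torus.ensembleDissipation (ν j) μ

/-- WEAKENING of TSE (holds trivially): the cone slope `κ` chosen AFTER `j`. -/
def TSEWithoutUniformKappa : Prop :=
  ∃ f : T3 → R3, Torus.IsSmooth f ∧ Torus.IsDivFree f ∧ Torus.HasZeroMean f ∧ f ≠ 0 ∧
    ∃ ν : ℕ → ℝ, (∀ j, 0 < ν j) ∧ Tendsto ν atTop (𝓝 0) ∧
      ∀ j : ℕ, ∃ κ : ℝ, 0 < κ ∧ ∃ R : ℝ, ∃ᶠ N in atTop, ∃ μ : Measure H3,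
        IsProbabilityMeasure μ ∧ (∀ᵐ u ∂μ, IsLevel N u) ∧ (∀ᵐ u ∂μ, ‖u‖ ≤ R) ∧
        (∀ d : ℕ, IsPolyStationary (ν j) f N d μ) ∧
        κ * Torus.ensembleEnergy μ ≤ Torus.ensembleDissipation (ν j) μ

/-- The Kolmogorov field `K_1` is not the zero force. -/
theorem kolField_one_ne_zero : kolField 1 ≠ 0 := by
  intro h
  have h1 := integral_norm_sq_kolField 1
  rw [h] at h1
  simp at h1

/-- **The laminar Dirac sits ON the cone of slope `4π²ν`**: `4π²ν · e = D` for `δ_{K_a}` (`e = a²/2`,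
`D = 2π²νa²`) — the Poincaré-extremal ratio, `→ 0` with `ν`. -/
theorem laminar_cone_eq (ν a : ℝ) :
    4 * Real.pi ^ 2 * ν * Torus.ensembleEnergy (Measure.dirac (kolState a)) =
      Torus.ensembleDissipation ν (Measure.dirac (kolState a)) := by
  rw [ensembleEnergy_dirac_kolState, ensembleDissipation_dirac_kolState]
  ring

/-- **The `j`-uniformity of `κ` is THE load-bearing clause of TSE** (hence of S4): with `κ_j := 4π²ν_j` the
laminar Kolmogorov Diracs `δ_{K_1/(4π²ν_j)}` are all-order invariant level-1 cone witnesses at every `j`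
(force `K_1 ≠ 0`, radius `(4π²ν_j)⁻¹`). Any proof of S4/TSE must produce orbits/laws beating the Poincaré
ratio `4π²ν_j` by the factor `κ/(4π²ν_j) → ∞` — spectral centroid at the Taylor wavenumber, uniformly. -/
theorem tseWithoutUniformKappa_holds : TSEWithoutUniformKappa := by
  have hpi : 0 < Real.pi := Real.pi_pos
  refine ⟨kolField 1, isSmooth_kolField 1, isDivFree_kolField 1, hasZeroMean_kolField 1, kolField_one_ne_zero,
    fun j => 1 / ((j : ℝ) + 1), fun j => by positivity, tendsto_one_div_add_atTop_nhds_zero_nat, fun j => ?_⟩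
  set ν : ℝ := 1 / ((j : ℝ) + 1) with hν
  have hν0 : 0 < ν := by positivity
  refine ⟨4 * Real.pi ^ 2 * ν, by positivity, (4 * Real.pi ^ 2 * ν)⁻¹,
    (eventually_ge_atTop 1).frequently.mono fun N hN => ?_⟩
  obtain ⟨hp, hl, hR, hinv, -, -⟩ := isGILWitness_dirac_kolState hν0 hN
  exact ⟨_, hp, hl, hR, (isInvariant_iff_forall).1 hinv, (laminar_cone_eq ν _).le⟩

/-- TSE ⇒ every cone witness obeys the Taylor-level floor `κ ≤ 4π²N²ν_j` as soon as its energy is positive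
(Bernstein; the skeleton's `cone_level`), and the force/radius floors of §2 with `ε := κ·e(μ)`. In particular a
cone family with uniform `κ` lives at levels `N ≥ (κ/ν_j)^{1/2}/(2π) → ∞`. -/
theorem cone_level' {f : T3 → R3} {ν : ℝ} (hν : 0 ≤ ν) {N : ℕ} {R κ : ℝ} {μ : Measure H3}
    (hp : IsProbabilityMeasure μ) (hl : ∀ᵐ u ∂μ, IsLevel N u) (hR : ∀ᵐ u ∂μ, ‖u‖ ≤ R)
    (hinv : ∀ d : ℕ, IsPolyStationary ν f N d μ)
    (hcone : κ * Torus.ensembleEnergy μ ≤ Torus.ensembleDissipation ν μ) (he : 0 < Torus.ensembleEnergy μ) :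
    κ ≤ 4 * Real.pi ^ 2 * (N : ℝ) ^ 2 * ν := by
  have hW : IsQuarticWitness f ν N (Torus.ensembleEnergy μ) (κ * Torus.ensembleEnergy μ) μ :=
    ⟨hp, hl, integrable_norm_pow_of_ae_le hR 4, hinv 4, le_rfl, hcone⟩
  exact le_of_mul_le_mul_right (hW.eps_le hν) he

end LineTaylorCone

end

end Summit.AnomalousDissipation.AnomalousDissipation.Theorems.GalerkinInvariantLoud.Negative
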